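import Mathlib
import Summits.ResolutionOfSingularities.ResolutionOfSingularities.Theorems.RadicialJungCleanModelsCleanPermissibleSeq
import Literature.AlgebraicGeometry.Resolution.GenericPointStalkData
import HarnessLib

/-!
# Route `RadicialJung`, crux `CleanModels` (stmt-ResolutionOfSingularities-15917), line `Sketch` rev 35, stub 6 `stub_cleanProp44` (X44c),
# work plan O8 / L7b-global, item (G3): at the GENERIC point of a curve, clean-regular IS clean-permissible

Memo `Cruxes/CleanModels/Lines/Sketch-memo-hand2-g9-stubs-5-7.md` §3 (L7b-global (G3)).  For a closed irreducible `C₀ = cl{η} ⊆ X₀` the stalk of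
its ideal at the generic point is the maximal ideal, `𝓘_{C₀,η} = 𝔪_η` (✓ `stalkIdeal_vanishingIdeal_eq_maximalIdeal_of_closure_eq`), and for the
maximal ideal clean-regular implies clean-permissible (✓ `CleanRegAt.cleanPermissibleAt_maximalIdeal`).  Hence on a clean stage of X44c (the line is
clean-regular at EVERY point) the condition `∀ y ∈ Y, CleanPermissibleAt …` of `IsCleanRegularCentreBlowupSeq.cons` for a curve centre `Y` only needs to
be checked at the CLOSED points of `Y` — where ✓ `exists_pointChain_cleanPermissibleAt_of_cleanRegAt` (L7b) produces it after point blow-ups.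

Honest framing: OURS (bookkeeping); nothing here proves X44c, resolution in characteristic `p`, or any case of `CleanModels`.
-/

noncomputable section

set_option linter.dupNamespace false -- mandated namespace of this single-conjunct summit

open CategoryTheory AlgebraicGeometry TopologicalSpace IsLocalRing
open Literature.AlgebraicGeometry.Resolution Literature.AlgebraicGeometry.Motives
open Scheme.IdealSheafData

namespace Summit.ResolutionOfSingularities.ResolutionOfSingularities.Theorems.RadicialJung.CleanModels

/-- **At the generic point of the curve, clean-regular ⟹ clean-permissible for the curve.** [cite: Piltant2013, §2 Axiom 4]
[cite: StacksProject, Tag 01J7] -/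
theorem cleanPermissibleAt_genericPoint_of_cleanRegAt {X₀ : Scheme.{0}} [IsIntegral X₀] (p : ℕ) [Fact p.Prime] [CharP X₀.functionField p]
    {C₀ : Closeds X₀} {η : X₀} (hη : (C₀ : Set X₀) = closure {η}) (G : X₀.functionField)
    (hG : CleanRegAt p (RatFn.toFunctionField η) G) :
    CleanPermissibleAt p (RatFn.toFunctionField η) G (stalkIdeal (vanishingIdeal C₀) η) := by
  rw [stalkIdeal_vanishingIdeal_eq_maximalIdeal_of_closure_eq hη]
  exact CleanRegAt.cleanPermissibleAt_maximalIdeal p (RatFn.toFunctionField η) hG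

/-- **On a scheme where the line is clean-regular everywhere, clean-permissibility of a closed irreducible centre only needs checking at its
non-generic points**: if `CleanPermissibleAt` holds at every point of `C₀ = cl{η}` other than `η`, it holds at every point of `C₀`.
[cite: Piltant2013, §2 Axiom 4] [cite: StacksProject, Tag 01J7] -/
theorem forall_cleanPermissibleAt_of_forall_ne_genericPoint {X₀ : Scheme.{0}} [IsIntegral X₀] (p : ℕ) [Fact p.Prime]
    [CharP X₀.functionField p] (G : X₀.functionField) (hclean : ∀ x : X₀, CleanRegAt p (RatFn.toFunctionField x) G)
    {C₀ : Closeds X₀} {η : X₀} (hη : (C₀ : Set X₀) = closure {η})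
    (h : ∀ y ∈ (C₀ : Set X₀), y ≠ η → CleanPermissibleAt p (RatFn.toFunctionField y) G (stalkIdeal (vanishingIdeal C₀) y)) :
    ∀ y ∈ (C₀ : Set X₀), CleanPermissibleAt p (RatFn.toFunctionField y) G (stalkIdeal (vanishingIdeal C₀) y) := by
  intro y hy
  by_cases hyη : y = η
  · subst hyη
    exact cleanPermissibleAt_genericPoint_of_cleanRegAt p hη G (hclean y)
  · exact h y hy hyη

end Summit.ResolutionOfSingularities.ResolutionOfSingularities.Theorems.RadicialJung.CleanModels

end
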